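import Literature.AlgebraicGeometry.HodgeTheory.ChernCharacterTautologicalPullback
import HarnessLib

/-!
# Functoriality of the Chern character across Hodge models, in all dimensions

Family `hodge`, layer `Literature/AlgebraicGeometry/HodgeTheory`. Companion to
`ChernCharacterTautologicalPullback`, which proves Kobayashi's naturality
`ch_p(f⁻¹V) = f^* ch_p(V)` (Ch. II §1 Axiom 2, §2 Thm. 2.16) for the tree's Chern character
`HodgeModel.chernCharacter` ACROSS two Hodge models `A` of `T` and `B` of `Y`, along a morphism
`ψ : T ⟶ Y` of smooth projective varieties, up to ONE non-zero scalar depending only on `(A, B)` —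
but only when `dim T ≤ dim Y` (`HodgeModel.chernCharacter_pullback_eq_smul_map_of_deRham_eq_smul`:
the comparison family `B.deRham` over `B.model`-manifolds is INDUCED down to `A.model`-manifolds
through the cylinder `Cyl(A^an) = A^an × ℝ^{2 dim Y - 2 dim T}` of `HodgeTypePullback`, and compared
with `A.deRham` by the rigidity of natural de Rham comparisons on the compact manifold `T^an`).

This file supplies the opposite case `dim Y ≤ dim T` — the one needed for projections
`A × B ⟶ A`, for the multiplication `A × A ⟶ A` of an abelian variety, and for every morphism onto
a lower-dimensional variety — and packages both into a dimension-free statement. For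
`dim Y ≤ dim T` the rôles of the two models in the cylinder construction are exchanged: now
`A.deRham` induces a natural family `e''` over `B.model`-manifolds (`HodgeModel.inducedIso A B hmn`),
rigidity on the compact manifold `Y^an` gives `B.deRham = r • e''` on `H²ᵖ_dR(Y^an; ℂ)` with `r ≠ 0`
(`HodgeModel.exists_ne_zero_deRham_eq_smul_inducedIso`, applied to `Y`), and the transport is by
naturality of `A.deRham` along the `C^∞` map `i ∘ ψ^an : T^an → Cyl(Y^an)` (`i` the zero section),
`π ∘ i = id`:

  `A^*(ψ^* ch_pᴮ(V)) = (ψ^an)^* B^* ch_pᴮ(V) = (ψ^an)^* B.deRham[ch_p(V,D)]`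
  `= r • (ψ^an)^* i^* A.deRham_{Cyl}[π^* ch_p(V,D)] = r • A.deRham[(π ∘ i ∘ ψ^an)^*_dR ch_p(V,D)]`
  `= r • A.deRham[(ψ^an)^*_dR ch_p(V,D)] = r • A.deRham[ch_p((ψ^an)⁻¹V, (ψ^an)^*D)] = r • A^* ch_pᴬ((ψ^an)⁻¹V)`,

whence `ch_pᴬ((ψ^an)⁻¹V) = r⁻¹ • ψ^* ch_pᴮ(V)` by injectivity of `A^*`.

## Results

* `HodgeModel.pullback_map_chernCharacter_eq_smul_deRham_of_le` — the transport displayed above.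
* `HodgeModel.chernCharacter_pullback_eq_smul_map_of_le` — `ch_pᴬ((ψ^an)⁻¹V) = r⁻¹ • ψ^* ch_pᴮ(V)`
  for `dim Y ≤ dim T`, `r` the rigidity scalar of `B` relative to `A`.
* `HodgeModel.exists_ne_zero_chernCharacter_pullback_eq_smul_map_of_le` — the packaged form: one
  `r ≠ 0` for all `ψ : T ⟶ Y`, all cocycles `V` on `Y^an` (`dim Y ≤ dim T`, `Y` smooth projective).
* `HodgeModel.exists_ne_zero_chernCharacter_pullback_eq_smul_map_of_ge` — the same packaging of the
  tree's case `dim T ≤ dim Y` (`T` smooth projective), with the connection hypothesis discharged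
  (`SmoothComplexVectorBundle.nonempty_connection`).
* `HodgeModel.exists_ne_zero_chernCharacter_pullback_eq_smul_map` — **all dimensions**: for smooth
  projective `T`, `Y` with Hodge models `A`, `B` and every `p` there is `r ≠ 0` in `ℂ` with
  `ch_pᴬ((ψ^an)⁻¹V) = r • ψ^* ch_pᴮ(V)` for every morphism `ψ : T ⟶ Y` and every cocycle `V` on `Y^an`.

Everything is proved; no definition and no named fact is introduced.

## References

* [Kobayashi1987] S. Kobayashi, *Differential Geometry of Complex Vector Bundles* (1987), Ch. II §1
  Axiom 2 («`c(f⁻¹E) = f^*(c(E))`»), §2 Thm. 2.16 and (2.20)–(2.21).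
* [VoisinHodgeI2002] C. Voisin, *Hodge Theory and Complex Algebraic Geometry I* (CUP 2002), §7.3.2
  (functoriality of `φ^*`), §11.2.
* [SerreGAGA1956] J.-P. Serre, *Géométrie algébrique et géométrie analytique*, Ann. Inst. Fourier 6
  (1956), §2 n°5 (`ψ^an` is holomorphic).
* [Milnor1963] J. Milnor, *Morse Theory* (1963), §3, §5 (rigidity of natural comparisons, through
  `NaturalDeRhamComparisonRigidity_holds`).
* [BottTu1982Forms] R. Bott, L. W. Tu, *Differential Forms in Algebraic Topology* (1982), §I.2.
-/

noncomputable section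

open scoped Manifold ContDiff
open CategoryTheory AlgebraicGeometry

namespace Literature.AlgebraicGeometry.HodgeTheory

section HodgeTheory

open Literature.AlgebraicGeometry Literature.Geometry.Kaehler Literature.AlgebraicTopology.SingularHomology
open Literature.NumberTheory.Transcendental (complexDeRhamCohomology)
open Literature.AlgebraicGeometry.Motives (IsSmoothProjective)

variable {n m : ℕ} {T Y : Motives.SchemeOver ℂ}

namespace HodgeModel

/-- **Transport of `ψ^* ch_p(V)` to `T^an`, source of dimension at least the target's.** For Hodge
models `A` of `T` (dimension `n`) and `B` of `Y` (dimension `m ≤ n`) with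
`B.deRham = r • e''` on `H²ᵖ_dR(Y^an; ℂ)`, `e'' = inducedIso A B hmn Y^an` the comparison over
`B.model`-manifolds induced from `A.deRham`, a morphism `ψ : T ⟶ Y` with `ψ^an` real `C^∞`, and a
cocycle `V` on `Y^an`: `A^*(ψ^* ch_p(V)) = r • A.deRham((ψ^an)^*_dR ch_p(V))` —
`B^* ch_p(V) = B.deRham(ch_p(V))` (`pullback_chernCharacter_eq`), `(ψ^an)^* ∘ B^* = A^* ∘ ψ^*`
(`map_anMap_pullback`), the unfolding `e'' = i^* ∘ A.deRham_{Cyl} ∘ π^*_dR`, naturality of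
`A.deRham` along `i ∘ ψ^an : T^an → Cyl(Y^an)` and `π ∘ i = id`.
[cite: VoisinHodgeI2002, §7.3.2] [cite: Kobayashi1987, Ch. II §2 Thm. 2.16] [cite: BottTu1982Forms, §I.2] -/
theorem pullback_map_chernCharacter_eq_smul_deRham_of_le (A : HodgeModel n T) (B : HodgeModel m Y)
    (hmn : m ≤ n) {p : ℕ} {r : ℂ}
    (hr : ∀ y : complexDeRhamCohomology B.model B.carrier (2 * p),
      B.deRham B.carrier (2 * p) y = r • inducedIso A B hmn B.carrier (2 * p) y)
    (ψ : T ⟶ Y) (hf : ContMDiff 𝓘(ℝ, A.model) 𝓘(ℝ, B.model) ∞ (anMap B A ψ))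
    {ι : Type} {s : ℕ} (V : SmoothComplexVectorBundle ι B.model B.carrier s) :
    A.pullback (2 * p) (complexBetti.map ψ (2 * p) (B.chernCharacter V p)) =
      r • A.deRham A.carrier (2 * p)
        (complexDeRhamCohomology.map A.model hf (2 * p) (V.chernCharacterDeRham p)) := by
  -- the `C^∞` map `i ∘ ψ^an : T^an → Cyl(Y^an)` between `A.model`-manifolds
  have hφ : ContMDiff 𝓘(ℝ, A.model) 𝓘(ℝ, A.model) ∞ (cylIncl A B hmn B.carrier ∘ anMap B A ψ) :=
    (contMDiff_cylIncl A B hmn B.carrier).comp hf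
  -- `(ψ^an)^*_dR = (i ∘ ψ^an)^*_dR ∘ π^*_dR` since `π ∘ i ∘ ψ^an = ψ^an`
  have hdR : complexDeRhamCohomology.map A.model hf (2 * p) (V.chernCharacterDeRham p) =
      complexDeRhamCohomology.map A.model hφ (2 * p)
        (complexDeRhamCohomology.map A.model (contMDiff_cylFst A B hmn B.carrier) (2 * p)
          (V.chernCharacterDeRham p)) := by
    rw [← LinearMap.comp_apply (f := complexDeRhamCohomology.map A.model hφ (2 * p)),
      ← complexDeRhamCohomology.map_comp (contMDiff_cylFst A B hmn B.carrier) hφ,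
      complexDeRhamCohomology.map_congr hf ((contMDiff_cylFst A B hmn B.carrier).comp hφ)
        (funext fun x ↦ rfl) (2 * p)]
  -- left-hand side: `A^*(ψ^* ch) = (ψ^an)^* (B^* ch) = (ψ^an)^* (B.deRham ch_dR) = r • (ψ^an)^* (e'' ch_dR)`
  rw [hdR, A.deRham_isNatural A.carrier (Cyl A B hmn B.carrier) _ hφ (2 * p)
      (complexDeRhamCohomology.map A.model (contMDiff_cylFst A B hmn B.carrier) (2 * p)
        (V.chernCharacterDeRham p))]
  have h1 : A.pullback (2 * p) (complexBetti.map ψ (2 * p) (B.chernCharacter V p)) =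
      (singularCohomology.map ℂ ℂ ⟨anMap B A ψ, continuous_anMap B A ψ⟩ (2 * p)).hom
        (B.pullback (2 * p) (B.chernCharacter V p)) := by
    rw [map_anMap_pullback]
  rw [h1, B.pullback_chernCharacter_eq, hr, map_smul, inducedIso_apply]
  congr 1
  change ((singularCohomology.map ℂ ℂ _ (2 * p) ≫ singularCohomology.map ℂ ℂ _ (2 * p)).hom _) = _
  rw [← singularCohomology.map_comp]
  rfl

/-- **`ch_p` of an induced cocycle, across Hodge models, source of dimension at least the target's,
up to the rigidity scalar.** With `r ≠ 0` as in `exists_ne_zero_deRham_eq_smul_inducedIso` applied to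
`Y` (`B.deRham = r • e''` in degree `2p`), for every morphism `ψ : T ⟶ Y` with `ψ^an` real `C^∞` and
every cocycle `V` on `Y^an`: `ch_pᴬ((ψ^an)⁻¹V) = r⁻¹ • ψ^* ch_pᴮ(V)` — Kobayashi's naturality
`ch_p(f⁻¹V) = f^*_dR ch_p(V)` (`chernCharacterDeRham_pullback`, for any connection on `V`, which
exists), `A^* ch_pᴬ = A.deRham(ch_p)` (`pullback_chernCharacter_eq`), the transport
`pullback_map_chernCharacter_eq_smul_deRham_of_le`, and injectivity of `A^*`.
[cite: Kobayashi1987, Ch. II §1 Axiom 2 and §2 Thm. 2.16] [cite: VoisinHodgeI2002, §7.3.2] -/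
theorem chernCharacter_pullback_eq_smul_map_of_le (A : HodgeModel n T) (B : HodgeModel m Y)
    (hmn : m ≤ n) {p : ℕ} {r : ℂ} (hr0 : r ≠ 0)
    (hr : ∀ y : complexDeRhamCohomology B.model B.carrier (2 * p),
      B.deRham B.carrier (2 * p) y = r • inducedIso A B hmn B.carrier (2 * p) y)
    (ψ : T ⟶ Y) (hf : ContMDiff 𝓘(ℝ, A.model) 𝓘(ℝ, B.model) ∞ (anMap B A ψ))
    {ι : Type} {s : ℕ} (V : SmoothComplexVectorBundle ι B.model B.carrier s) :
    A.chernCharacter (V.pullback (anMap B A ψ) hf) p =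
      r⁻¹ • complexBetti.map ψ (2 * p) (B.chernCharacter V p) := by
  obtain ⟨D⟩ := V.nonempty_connection
  have h1 : (V.pullback (anMap B A ψ) hf).chernCharacterDeRham p =
      complexDeRhamCohomology.map A.model hf (2 * p) (V.chernCharacterDeRham p) :=
    SmoothComplexVectorBundle.chernCharacterDeRham_pullback
      (SmoothComplexVectorBundle.exists_isChernCharacterForm_holds B.model B.carrier)
      (SmoothComplexVectorBundle.mk_eq_mk_of_isChernCharacterForm_holds B.model B.carrier)
      (SmoothComplexVectorBundle.mk_eq_mk_of_isChernCharacterForm_holds A.model A.carrier) D hf p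
  apply A.pullback_injective (2 * p)
  rw [A.pullback_chernCharacter_eq, h1, map_smul,
    pullback_map_chernCharacter_eq_smul_deRham_of_le A B hmn hr ψ hf V, smul_smul,
    inv_mul_cancel₀ hr0, one_smul]

/-- **Functoriality of `ch_p` across Hodge models for `dim Y ≤ dim T`, up to ONE non-zero scalar.**
For a smooth projective `Y` of dimension `m` with Hodge model `B`, any `T` of dimension `n ≥ m` with
Hodge model `A`, and every `p`, there is `r ≠ 0` in `ℂ` such that for every morphism `ψ : T ⟶ Y`
with `ψ^an` real `C^∞` and every cocycle `V` on `Y^an`: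
`ch_pᴬ((ψ^an)⁻¹V) = r • ψ^* ch_pᴮ(V)` in `H²ᵖ(T(ℂ); ℂ)` (Kobayashi, Ch. II §1 Axiom 2,
"`c(f⁻¹E) = f^*(c(E))`"; the scalar compares the normalisations `A.deRham`, `B.deRham` of the two
Hodge models through the cylinder over `Y^an` and the rigidity of natural comparisons on the compact
manifold `Y^an`). [cite: Kobayashi1987, Ch. II §1 Axiom 2 and §2 Thm. 2.16]
[cite: VoisinHodgeI2002, §7.3.2 and §11.2] [cite: Milnor1963, Thm. 3.5 and §5] -/
theorem exists_ne_zero_chernCharacter_pullback_eq_smul_map_of_le (hY : IsSmoothProjective m Y)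
    (A : HodgeModel n T) (B : HodgeModel m Y) (hmn : m ≤ n) (p : ℕ) :
    ∃ r : ℂ, r ≠ 0 ∧ ∀ (ψ : T ⟶ Y) (hf : ContMDiff 𝓘(ℝ, A.model) 𝓘(ℝ, B.model) ∞ (anMap B A ψ))
      {ι : Type} {s : ℕ} (V : SmoothComplexVectorBundle ι B.model B.carrier s),
      A.chernCharacter (V.pullback (anMap B A ψ) hf) p =
        r • complexBetti.map ψ (2 * p) (B.chernCharacter V p) := by
  obtain ⟨r, hr0, hr⟩ := exists_ne_zero_deRham_eq_smul_inducedIso hY B A hmn (2 * p)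
  exact ⟨r⁻¹, inv_ne_zero hr0, fun ψ hf _ _ V ↦
    chernCharacter_pullback_eq_smul_map_of_le A B hmn hr0 hr ψ hf V⟩

/-- **Functoriality of `ch_p` across Hodge models for `dim T ≤ dim Y`, up to ONE non-zero scalar**
— the tree's `chernCharacter_pullback_eq_smul_map_of_deRham_eq_smul` with the rigidity scalar of
`exists_ne_zero_deRham_eq_smul_inducedIso` (on the compact manifold `T^an`, `T` smooth projective)
and the connection hypothesis discharged (`SmoothComplexVectorBundle.nonempty_connection`).
[cite: Kobayashi1987, Ch. II §1 Axiom 2 and §2 Thm. 2.16] [cite: VoisinHodgeI2002, §7.3.2 and §11.2]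
[cite: Milnor1963, Thm. 3.5 and §5] -/
theorem exists_ne_zero_chernCharacter_pullback_eq_smul_map_of_ge (hT : IsSmoothProjective n T)
    (A : HodgeModel n T) (B : HodgeModel m Y) (hnm : n ≤ m) (p : ℕ) :
    ∃ r : ℂ, r ≠ 0 ∧ ∀ (ψ : T ⟶ Y) (hf : ContMDiff 𝓘(ℝ, A.model) 𝓘(ℝ, B.model) ∞ (anMap B A ψ))
      {ι : Type} {s : ℕ} (V : SmoothComplexVectorBundle ι B.model B.carrier s),
      A.chernCharacter (V.pullback (anMap B A ψ) hf) p =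
        r • complexBetti.map ψ (2 * p) (B.chernCharacter V p) := by
  obtain ⟨r, hr0, hr⟩ := exists_ne_zero_deRham_eq_smul_inducedIso hT A B hnm (2 * p)
  refine ⟨r, hr0, fun ψ hf _ _ V ↦ ?_⟩
  obtain ⟨D⟩ := V.nonempty_connection
  exact chernCharacter_pullback_eq_smul_map_of_deRham_eq_smul A B hnm hr ψ hf V D

/-- **Functoriality of the Chern character across Hodge models, all dimensions.** For smooth
projective `T` (dimension `n`, Hodge model `A`) and `Y` (dimension `m`, Hodge model `B`) and every
`p` there is `r ≠ 0` in `ℂ` such that for EVERY morphism `ψ : T ⟶ Y` and every cocycle `V` on `Y^an`: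
`ch_pᴬ((ψ^an)⁻¹V) = r • ψ^* ch_pᴮ(V)` in `H²ᵖ(T(ℂ); ℂ)`, `ψ^an` being real `C^∞` by GAGA
(`contMDiff_anMap`). Kobayashi, Ch. II §1 Axiom 2 «`c(f⁻¹E) = f^*(c(E))`», read through the tree's
two-model encoding: `r` compares the normalisations of the comparison isomorphisms of `A` and `B`
(`r = 1` when both are the standard de Rham isomorphism) and does not depend on `ψ` or `V`.
[cite: Kobayashi1987, Ch. II §1 Axiom 2 and §2 Thm. 2.16] [cite: VoisinHodgeI2002, §7.3.2 and §11.2]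
[cite: SerreGAGA1956, §2 n°5] [cite: Milnor1963, Thm. 3.5 and §5] -/
theorem exists_ne_zero_chernCharacter_pullback_eq_smul_map (hT : IsSmoothProjective n T)
    (hY : IsSmoothProjective m Y) (A : HodgeModel n T) (B : HodgeModel m Y) (p : ℕ) :
    ∃ r : ℂ, r ≠ 0 ∧ ∀ (ψ : T ⟶ Y) {ι : Type} {s : ℕ}
      (V : SmoothComplexVectorBundle ι B.model B.carrier s),
      A.chernCharacter (V.pullback (anMap B A ψ) (contMDiff_anMap B A ψ hT hY)) p =
        r • complexBetti.map ψ (2 * p) (B.chernCharacter V p) := by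
  rcases le_total m n with hmn | hnm
  · obtain ⟨r, hr0, hr⟩ := exists_ne_zero_chernCharacter_pullback_eq_smul_map_of_le hY A B hmn p
    exact ⟨r, hr0, fun ψ _ _ V ↦ hr ψ _ V⟩
  · obtain ⟨r, hr0, hr⟩ := exists_ne_zero_chernCharacter_pullback_eq_smul_map_of_ge hT A B hnm p
    exact ⟨r, hr0, fun ψ _ _ V ↦ hr ψ _ V⟩

end HodgeModel

end HodgeTheory

end Literature.AlgebraicGeometry.HodgeTheory

end
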